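import Mathlib
import Literature.NumberTheory.Sieve.BatemanHorn

/-!
Sketch (crux-ideate, ideator 1) for crux `SelbergDelangeRigidity.LSDRealSegment` (stmt-Parity-9770).
First lemmas of the two idea cards `ewens-anchor-normal-form` and `subunit-cofactor-sandwich`.
Scratch only: local defs live in a scratch namespace; nothing here is filed as an item.
-/

open scoped BigOperators ArithmeticFunction.omega ArithmeticFunction.Omega
open Filter Finset Polynomial

namespace Summit.Parity.BatemanHorn.Cruxes.LSDRealSegment.Ideator1

noncomputable section

variable {k : ℕ}

/-- `F(n) = ∏ᵢ fᵢ(n)` as a natural number (junk `0` if some `fᵢ(n) ≤ 0`; finitely many `n`). -/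
def prodVal (f : Fin k → ℤ[X]) (n : ℕ) : ℕ := ∏ i, ((f i).eval (n : ℤ)).toNat

/-- `Ω_f(n) = Σᵢ Ω(fᵢ(n))`, the crux's statistic. -/
def OmegaF (f : Fin k → ℤ[X]) (n : ℕ) : ℕ := ∑ i, Ω (((f i).eval (n : ℤ)).toNat)

/-- `S_x(y) = Σ_{n ≤ x} y^{Ω_f(n)}` (the unnormalised crux sum at real `y`). -/
def S (f : Fin k → ℤ[X]) (y : ℝ) (x : ℕ) : ℝ := ∑ n ∈ range (x + 1), y ^ OmegaF f n

/-- The divisor weight `g_y = y^Ω ⋆ μ`: multiplicative, `g_y(p^ν) = y^{ν-1}(y-1)`, so that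
`y^{Ω(N)} = Σ_{e ∣ N} g_y(e)`; closed form `(y-1)^{ω(e)} y^{Ω(e)-ω(e)}`. -/
def gY (y : ℝ) (e : ℕ) : ℝ := (y - 1) ^ ω e * y ^ (Ω e - ω e)

/-- Type-I half `T_I(x,y) = Σ_{n ≤ x} Σ_{e ∣ F(n), e ≤ n} g_y(e)` (divisors below `√F(n) ≈ n^{D/2}`;
for total degree `2` this is exactly the level-`≤ x` half of the Dirichlet–Hooley splitting). -/
def typeIHalf (f : Fin k → ℤ[X]) (y : ℝ) (x : ℕ) : ℝ :=
  ∑ n ∈ range (x + 1), ∑ e ∈ (Nat.divisors (prodVal f n)).filter (· ≤ n), gY y e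

/-- Local density `P(p^ν ∥ F(n))` (exact: periodic mod `p^{ν+1}`). -/
def densF (f : Fin k → ℤ[X]) (p ν : ℕ) : ℝ :=
  (((range (p ^ (ν + 1))).filter fun n : ℕ =>
      ((p : ℤ) ^ ν ∣ ∏ i, (f i).eval (n : ℤ)) ∧ ¬ ((p : ℤ) ^ (ν + 1) ∣ ∏ i, (f i).eval (n : ℤ))).card : ℝ)
    / (p : ℝ) ^ (ν + 1)

/-- Euler factor `E_p(z) = 𝔼 z^{v_p(F(n))} = Σ_ν densF p ν · z^ν`. -/
def eulerE (f : Fin k → ℤ[X]) (p : ℕ) (z : ℂ) : ℂ := ∑' ν : ℕ, (densF f p ν : ℂ) * z ^ ν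

/-- Ordered partial products of the conjectural LSD Euler product `λ_f(z) = ∏_p E_p(z)(1-1/p)^{k(z-1)}`. -/
def lsdEulerPartial (f : Fin k → ℤ[X]) (z : ℂ) (P : ℕ) : ℂ :=
  ∏ p ∈ Nat.primesLE P, eulerE f p z * ((1 : ℂ) - 1 / (p : ℂ)) ^ ((k : ℂ) * (z - 1))

/-- `λ_f(z)` as an ordered limit (junk if divergent). -/
def lsdEuler (f : Fin k → ℤ[X]) (z : ℂ) : ℂ := limUnder atTop (lsdEulerPartial f z)

/-! ### Card `ewens-anchor-normal-form`: first lemmas -/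

/-- (A) EulerFactorPin — provable bookkeeping: `λ_f` is a locally uniform limit, holomorphic on
`|z| < 2`, with `λ_f(0) = C(f)` (each factor at `z = 0` is `(1 - ω_f(p)/p)(1-1/p)^{-k}`, the
Bateman–Horn factor) and `λ_f(1) = 1`. This PINS the crux's `∃ Λ`. -/
def EulerFactorPin : Prop :=
  ∀ (k : ℕ) (f : Fin k → ℤ[X]), Literature.NumberTheory.Sieve.IsBatemanHornSystem f →
    TendstoLocallyUniformlyOn (fun P z => lsdEulerPartial f z P) (lsdEuler f) atTop (Metric.ball 0 2) ∧
    DifferentiableOn ℂ (lsdEuler f) (Metric.ball 0 2) ∧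
    lsdEuler f 0 = (Literature.NumberTheory.Sieve.batemanHornConst f : ℂ) ∧ lsdEuler f 1 = 1

/-- (B) TypeIAnchor — provable (Type-I level `≤ x` + Wirsing/LSD mean value over the INTEGERS of the
non-negative multiplicative function `e ↦ g_y(e)ρ_F(e)/e` of dimension `κ = k(y-1)`):
`T_I(x,y) ~ λ_f(y) · x (log x)^{κ} / Γ(κ+1)`. -/
def TypeIAnchor : Prop :=
  ∀ (k : ℕ) (f : Fin k → ℤ[X]), Literature.NumberTheory.Sieve.IsBatemanHornSystem f →
    ∀ y : ℝ, 1 < y → y < 2 →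
      Tendsto (fun x : ℕ => (x : ℝ)⁻¹ * (Real.log x) ^ (-((k : ℝ) * (y - 1))) * typeIHalf f y x) atTop
        (nhds ((lsdEuler f y).re / Real.Gamma (k * (y - 1) + 1)))

/-- (C) EwensRatioLaw — the `λ`-FREE complement, crux-equivalent given (A)+(B): the large-divisor half
contributes exactly the Poisson–Dirichlet/Ewens factor, `S_x(y)/T_I(x,y) → D^{y-1} Γ(k(y-1)+1)/Γ(y)^k`,
`D = ∏ deg fᵢ` (= Hooley's switching factor `2` at `y = 2`, `k = 1`, `D = 2`; = `1` at `y = 1`). -/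
def EwensRatioLaw : Prop :=
  ∀ (k : ℕ) (f : Fin k → ℤ[X]), Literature.NumberTheory.Sieve.IsBatemanHornSystem f →
    ∀ y : ℝ, 5 / 4 < y → y < 7 / 4 →
      Tendsto (fun x : ℕ => S f y x / typeIHalf f y x) atTop
        (nhds ((∏ i, ((f i).natDegree : ℝ)) ^ (y - 1) * Real.Gamma (k * (y - 1) + 1) / Real.Gamma y ^ k))

/-- Composition target (logic + `Complex.ofReal` bookkeeping, to be checked in crux-plan):
(A) ∧ (B) ∧ (C) → the crux, with `Λ := lsdEuler f`. Stated here only as the implication shape. -/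
def NormalFormImpliesCrux : Prop :=
  EulerFactorPin → TypeIAnchor → EwensRatioLaw →
    ∀ (k : ℕ) (f : Fin k → ℤ[X]), Literature.NumberTheory.Sieve.IsBatemanHornSystem f →
      ∃ Λ : ℂ → ℂ, DifferentiableOn ℂ Λ (Metric.ball 0 2) ∧
        Λ 0 = (Literature.NumberTheory.Sieve.batemanHornConst f : ℂ) ∧
        ∀ y : ℝ, 5 / 4 < y → y < 7 / 4 →
          Tendsto (fun x : ℕ => (x : ℂ)⁻¹ * Complex.exp ((k : ℂ) * (1 - (y : ℂ)) * (Real.log (Real.log x) : ℂ)) *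
              ∑ n ∈ range (x + 1), (y : ℂ) ^ (∑ i, ArithmeticFunction.cardFactors (((f i).eval (n : ℤ)).toNat)))
            atTop (nhds (Λ y * Complex.exp (((y : ℂ) - 1) * (Real.log (∏ i, ((f i).natDegree : ℝ)) : ℂ)) *
              (Complex.Gamma y)⁻¹ ^ k))

/-- (U) UncappedShortIntervalBound — the Nair–Tenenbaum/Henriot upper bound for the UN-capped tilt `y^{Ω_f}`,
which lies OUTSIDE Shiu's class `M` (`y^{Ω(2^ν)} = y^ν` is not `≪ (2^ν)^ε`): peel the primes `p < y^{1/ε}` by hand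
(densities `≍ p^{-ν}` against weights `y^ν`: convergent iff `y < p`, i.e. iff `y < 2` at `p = 2` — the essential use of
`y < 2` demanded by `Negative.WallAtTwoSharp`), then apply the class-`M` bound to the peeled statistic. Provable (L) from a
vendored Nair–Tenenbaum 1998 Thm 1 / Henriot 2012 Thm 3. Feeds every tail/top-class estimate of an uncapped line. -/
def UncappedShortIntervalBound : Prop :=
  ∀ (k : ℕ) (f : Fin k → ℤ[X]), Literature.NumberTheory.Sieve.IsBatemanHornSystem f →
    ∀ y : ℝ, 1 ≤ y → y < 2 → ∀ ε : ℝ, 0 < ε → ∃ C : ℝ, ∀ᶠ x : ℕ in atTop, ∀ h : ℕ,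
      (x : ℝ) ^ ε ≤ h → h ≤ x →
        ∑ n ∈ Ioc x (x + h), y ^ OmegaF f n ≤ C * h * (Real.log x) ^ ((k : ℝ) * (y - 1))

/-! ### Card `subunit-cofactor-sandwich`: first lemmas -/

/-- `z`-smooth part of `M`. -/
def smoothPart (z M : ℕ) : ℕ := ∏ p ∈ M.primeFactors.filter (· < z), p ^ M.factorization p

/-- Sub-unit co-factor sum with the ROUGH part's weight replaced by `1`:
`K_η(x,y) = Σ_{n ≤ x} Σ_{m ∣ F(n), m < n} g_y(smooth_{x^η} part of F(n)/m)` — fundamental-lemma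
computable for moduli `m · smooth ≤ x^{1-δ}` (Type-I level `x`), window/Rankin tails `O(δ)`. -/
def roughFreeHalf (f : Fin k → ℤ[X]) (η y : ℝ) (x : ℕ) : ℝ :=
  ∑ n ∈ range (x + 1), ∑ m ∈ (Nat.divisors (prodVal f n)).filter (· < n),
    gY y (smoothPart ⌈(x : ℝ) ^ η⌉₊ (prodVal f n / m))

/-- (D) SubunitSandwich (total degree 2, `k = 1`: first open instance beyond `f = X`). Dirichlet–Hooley
switching turns the large-divisor half into the SUB-UNIT moment (parameter `y - 1 ∈ (1/4,3/4)`) of the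
co-factor family; positivity and `Ω(rough part) ≤ 2/η + o(1)` sandwich the rough weight between
`(y-1)^{⌈2/η⌉+1}` and `1` (square-full rough parts negligible), i.e. `U` between those multiples of the rough-free
count `K_η`, whose ratio to `T_I` is pinned to within `η` (fundamental lemma for moduli `≤ x^{1-√η}`, Type-I LSD,
window `O(√η)`). Provable now (L/XL): -/
def SubunitSandwich : Prop :=
  ∀ (f : Fin 1 → ℤ[X]), Literature.NumberTheory.Sieve.IsBatemanHornSystem f → (f 0).natDegree = 2 →
    ∀ y : ℝ, 1 < y → y < 2 → ∀ η : ℝ, 0 < η → η < 1 / 4 →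
      ∃ r : ℝ, 0 < r ∧
        (∀ᶠ x : ℕ in atTop, |roughFreeHalf f η y x / typeIHalf f y x - r| ≤ η) ∧
        (∀ᶠ x : ℕ in atTop, S f y x / typeIHalf f y x ≤ 1 + r + 2 * η) ∧
        (∀ᶠ x : ℕ in atTop, 1 + (y - 1) ^ (⌈2 / η⌉₊ + 1) * r - 2 * η ≤ S f y x / typeIHalf f y x)

/-- (E) EndpointSqueeze — `λ`-free consequence of (D) + continuity at Hooley's solvable point `y = 2`
(where `g_2 ≡ 1` on squarefree co-factors): the Ewens ratio law holds in the limit `y → 2⁻`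
uniformly in `x`, for every irreducible quadratic. -/
def EndpointSqueeze : Prop :=
  ∀ (f : Fin 1 → ℤ[X]), Literature.NumberTheory.Sieve.IsBatemanHornSystem f → (f 0).natDegree = 2 →
    ∀ ε : ℝ, 0 < ε → ∃ y₀ : ℝ, y₀ < 2 ∧ ∀ y : ℝ, y₀ < y → y < 2 →
      ∀ᶠ x : ℕ in atTop, |S f y x / typeIHalf f y x - (2 : ℝ) ^ (y - 1)| ≤ ε

end

end Summit.Parity.BatemanHorn.Cruxes.LSDRealSegment.Ideator1
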